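import Mathlib.Combinatorics.SimpleGraph.Sum
import Mathlib.GroupTheory.OrderOfElement
import Literature.Topology.FourManifolds.GaussDiagramsConnSum
import Literature.Topology.FourManifolds.KhFlipReach
import Literature.Topology.FourManifolds.KhResolutionsProofs
import Literature.Topology.FourManifolds.KhCurlArcs
import Literature.Topology.FourManifolds.KhFaces
import HarnessLib

/-!
# State circles of the connected sum of two Gauss diagrams

Sibling file of `GaussDiagramsConnSum.lean` and `KhResolutions.lean` (topic
`Literature/Topology/FourManifolds`), second brick (after `GaussDiagram.connSum`) of the
diagrammatic additivity `s(D₁ # D₂) = s(D₁) + s(D₂)` of Rasmussen's invariant (Rasmussen (2010),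
Prop. 3.11; the named fact `HasRasmussenInvariant.add` of `Rasmussen.lean`). It describes the
complete resolutions of the connected sum `G # H` in terms of those of `G` and `H`:

* bookkeeping (`§ Blocks`): arcs (`inlArc`, `inrArc`, `arcEquiv`), arc-ends (`inlEnd`, `inrEnd`),
  chords, partners, the Seifert rule and the gluing of ends of `G # H` blockwise; states of
  `G # H` are `Fin.append σ₁ σ₂`; weights, `n₊`, `n₋` and Koszul signs (`edgeSign_append_castAdd`,
  `edgeSign_append_natAdd`);
* the **reconnection graph of `G # H`** (`§ Trade`): on arcs identified with `G.Arc ⊕ H.Arc`, the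
  state graph of `Fin.append σ₁ σ₂` is the disjoint union of the two state graphs with the two
  gluings at the base points *traded* — the head of the base arc of `G` (the arc entering its base
  point) is glued into `H` and conversely (`adj_connSumGraph_imp`, `adj_sumGraph_imp`) — so that
  the abstract edge-trade lemma `reachable_trade_iff_mergedReach` of `KhFlipReach` applies, its
  one substantial hypothesis (the two base arcs lie on one circle of `G # H`,
  `reachable_baseArc`) being a walk around the base circle of `H` (`§ Walk`);
* the result (`§ Circles`): **the state circles of `G # H` in the state `(σ₁, σ₂)` are those of
  `σ₁` and of `σ₂` with the two base circles united** — stated as the abstract surgery relation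
  `KhFace.Surg` of `KhFaces` between the blockwise circle map and the circle map of `G # H`
  (`connSum_surg`), with the corollaries used by the Khovanov–Lee complex of `G # H`: circles of
  one block embed (`circleOf_inlArc_eq_iff`, `circleOf_inrArc_eq_iff`), the mixed case
  (`circleOf_inlArc_eq_inrArc_iff`), merges and splits are blockwise (`isMergeAt_append_castAdd`,
  `isSplitAt_append_castAdd`, `…_natAdd`).

This is the combinatorial content of "the diagram for `K₁ # K₂` shown in Figure 3" of Rasmussen
(2010), Lemma 3.8 / Prop. 3.11, and of Khovanov's description of the chain complex of a connected
sum as a tensor product over `A` (Khovanov (2006), Prop. 3.3's setting; Lee (2005), §5): every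
resolution of `D₁ # D₂` is the connected sum of a resolution of `D₁` and a resolution of `D₂`
along the base arcs. Everything is proved, for all Gauss diagrams with at least one chord each
(the empty summand is the relabelling `GaussDiagram.connSum_empty`); no named fact is introduced.

## References

* J. Rasmussen, *Khovanov homology and the slice genus*, Invent. Math. 182 (2010) 419–447
  (arXiv:math/0402131), Lemma 3.8, Fig. 3, Prop. 3.11. [cite: Rasmussen2010, Lemma 3.8]
* M. Khovanov, *A categorification of the Jones polynomial*, Duke Math. J. 101 (2000), §4.2
  (cube of resolutions), §7.4 (Khovanov homology of a connected sum: the short exact sequence).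
  [cite: Khovanov2000, §4.2]
* O. Viro, *Khovanov homology, its definitions and ramifications*, Fund. Math. 184 (2004), §2,
  §5.2 (resolutions of a Gauss diagram as abstract surgery of the circle). [cite: Viro2004, §5.2]

## Design notes

The picture is cleanest on arc-*ends* (`Fin (2 n) × Bool`, `KhResolutions.endArc/endFlip/endGlue`):
the ends of `G # H` are the ends of `G` and of `H` (`inlEnd`, `inrEnd`), the gluing `endGlue` of
`G # H` is that of the blocks on the nose (`endGlue_inlEnd`, `endGlue_inrEnd`), and only the
incidence "end ↦ arc" changes, at the two heads of the base arcs (`endArc_inlEnd_zero`,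
`endArc_inrEnd_zero`). Hypotheses `0 < G.n`, `0 < H.n` are carried where the arithmetic of
`arcCount = max (2 n) 1` needs them.
-/

open Function Set

noncomputable section

namespace Literature.Topology.FourManifolds

namespace GaussDiagram

variable (G H : GaussDiagram)

/-! ## Blocks: arcs, ends, chords and states of `G # H` -/

section Blocks

/-- `arcCount ≥ 1`. [folklore] -/
theorem one_le_arcCount : 1 ≤ G.arcCount := le_max_right _ _

/-- The base arc `GaussDiagram.baseArc` (`KhCurlArcs`: the last arc `2 n - 1`, entering the base
point) is the arc entering the base point `0`. The connected sum `G # H` is the band sum of the two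
diagrams along their base arcs. [folklore] -/
theorem arcIn_zero (h : 0 < G.n) : G.arcIn ⟨0, by omega⟩ = G.baseArc := by
  refine Fin.ext ?_
  rw [val_baseArc]
  simp only [arcIn, zero_add]
  rw [Nat.mod_eq_of_lt (by omega)]

/-- The base arc is the arc leaving the last marked point `2 n - 1`. [folklore] -/
theorem arcOut_last (h : 0 < G.n) : G.arcOut ⟨2 * G.n - 1, by omega⟩ = G.baseArc :=
  Fin.ext (by rw [val_baseArc]; rfl)

/-- The successor of the last marked point is the base point. [folklore] -/
theorem succPt_last (h : 0 < G.n) : G.succPt ⟨2 * G.n - 1, by omega⟩ = ⟨0, by omega⟩ := by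
  refine Fin.ext ?_
  simp only [succPt]
  rw [show 2 * G.n - 1 + 1 = 2 * G.n by omega, Nat.mod_self]

/-- The arc `a` of `G` as an arc of `G # H` (same number). [folklore] -/
def inlArc (a : G.Arc) : (G.connSum H).Arc :=
  ⟨a, by have := a.isLt; unfold arcCount at *; simp only [connSum_n]; omega⟩

/-- The arc `b` of `H` as an arc of `G # H` (number `2 n₁ + b`; written with `%` to be total, see
`inrArc_val`). [folklore] -/
def inrArc (b : H.Arc) : (G.connSum H).Arc :=
  ⟨(2 * G.n + b) % (G.connSum H).arcCount,
    Nat.mod_lt _ (by have := (G.connSum H).one_le_arcCount; omega)⟩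

/-- The value of a first-block arc. [folklore] -/
@[simp] theorem inlArc_val (a : G.Arc) : (G.inlArc H a : ℕ) = a := rfl

/-- The value of a second-block arc. [folklore] -/
theorem inrArc_val (hH : 0 < H.n) (b : H.Arc) : (G.inrArc H b : ℕ) = 2 * G.n + b := by
  have := b.isLt
  simp only [inrArc, arcCount, connSum_n] at this ⊢
  rw [Nat.mod_eq_of_lt (by omega)]

/-- `inlArc` is injective. [folklore] -/
theorem inlArc_injective : Injective (G.inlArc H) := fun a a' h ↦
  Fin.ext (by simpa using congrArg Fin.val h)

/-- `inrArc` is injective (second summand nonempty). [folklore] -/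
theorem inrArc_injective (hH : 0 < H.n) : Injective (G.inrArc H) := fun b b' h ↦
  Fin.ext (by have := congrArg Fin.val h; rw [inrArc_val G H hH, inrArc_val G H hH] at this; omega)

/-- The two blocks of arcs are disjoint (first summand nonempty). [folklore] -/
theorem inlArc_ne_inrArc (hG : 0 < G.n) (hH : 0 < H.n) (a : G.Arc) (b : H.Arc) :
    G.inlArc H a ≠ G.inrArc H b := by
  intro h
  have h' := congrArg Fin.val h
  rw [inlArc_val, inrArc_val G H hH] at h'
  have := a.isLt
  simp only [arcCount] at this
  omega

/-- **The arcs of `G # H` are the arcs of `G` and the arcs of `H`** (both summands nonempty).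
[folklore] -/
def arcEquiv (hG : 0 < G.n) (hH : 0 < H.n) : G.Arc ⊕ H.Arc ≃ (G.connSum H).Arc where
  toFun := Sum.elim (G.inlArc H) (G.inrArc H)
  invFun r :=
    if h : (r : ℕ) < 2 * G.n then Sum.inl ⟨r, by unfold arcCount; omega⟩
    else Sum.inr ⟨r - 2 * G.n, by
      have := r.isLt; unfold arcCount at *; simp only [connSum_n] at this; omega⟩
  left_inv x := by
    rcases x with a | b
    · have ha := a.isLt
      simp only [arcCount] at ha
      simp only [Sum.elim_inl, inlArc_val]
      rw [dif_pos (by omega)]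
    · simp only [Sum.elim_inr]
      rw [dif_neg (by rw [inrArc_val G H hH]; omega)]
      congr 1
      exact Fin.ext (by simp [inrArc_val G H hH])
  right_inv r := by
    by_cases h : (r : ℕ) < 2 * G.n
    · simp only [h, ↓reduceDIte, Sum.elim_inl]
      exact Fin.ext rfl
    · simp only [h, ↓reduceDIte, Sum.elim_inr]
      exact Fin.ext (by rw [inrArc_val G H hH]; simp only; omega)

/-- `arcEquiv` on the first block. [folklore] -/
@[simp] theorem arcEquiv_inl (hG : 0 < G.n) (hH : 0 < H.n) (a : G.Arc) :
    G.arcEquiv H hG hH (Sum.inl a) = G.inlArc H a := rfl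

/-- `arcEquiv` on the second block. [folklore] -/
@[simp] theorem arcEquiv_inr (hG : 0 < G.n) (hH : 0 < H.n) (b : H.Arc) :
    G.arcEquiv H hG hH (Sum.inr b) = G.inrArc H b := rfl

/-- An arc-end of `G` as an arc-end of `G # H`. [folklore] -/
def inlEnd (e : Fin (2 * G.n) × Bool) : Fin (2 * (G.connSum H).n) × Bool :=
  (G.inlPos H e.1, e.2)

/-- An arc-end of `H` as an arc-end of `G # H`. [folklore] -/
def inrEnd (e : Fin (2 * H.n) × Bool) : Fin (2 * (G.connSum H).n) × Bool :=
  (G.inrPos H e.1, e.2)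

/-- Every arc-end of `G # H` is an arc-end of `G` or of `H`. [folklore] -/
theorem eq_inlEnd_or_eq_inrEnd (e : Fin (2 * (G.connSum H).n) × Bool) :
    (∃ e₁, e = G.inlEnd H e₁) ∨ ∃ e₂, e = G.inrEnd H e₂ := by
  obtain ⟨r, b⟩ := e
  rcases G.eq_inlPos_or_eq_inrPos H r with ⟨p, rfl⟩ | ⟨q, rfl⟩
  · exact Or.inl ⟨(p, b), rfl⟩
  · exact Or.inr ⟨(q, b), rfl⟩

/-- The chord of `G # H` through a first-block point. [folklore] -/
theorem chordOf_inlPos (p : Fin (2 * G.n)) :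
    (G.connSum H).chordOf (G.inlPos H p) = Fin.castAdd H.n (G.chordOf p) := by
  rcases G.chordOf_spec p with h | h
  · have : G.inlPos H p = (G.connSum H).overPos (Fin.castAdd H.n (G.chordOf p)) := by
      rw [connSum_overPos_castAdd, h]
    rw [this, chordOf_overPos]
  · have : G.inlPos H p = (G.connSum H).underPos (Fin.castAdd H.n (G.chordOf p)) := by
      rw [connSum_underPos_castAdd, h]
    rw [this, chordOf_underPos]

/-- The chord of `G # H` through a second-block point. [folklore] -/
theorem chordOf_inrPos (q : Fin (2 * H.n)) :
    (G.connSum H).chordOf (G.inrPos H q) = Fin.natAdd G.n (H.chordOf q) := by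
  rcases H.chordOf_spec q with h | h
  · have : G.inrPos H q = (G.connSum H).overPos (Fin.natAdd G.n (H.chordOf q)) := by
      rw [connSum_overPos_natAdd, h]
    rw [this, chordOf_overPos]
  · have : G.inrPos H q = (G.connSum H).underPos (Fin.natAdd G.n (H.chordOf q)) := by
      rw [connSum_underPos_natAdd, h]
    rw [this, chordOf_underPos]

/-- The partner of a first-block point. [folklore] -/
theorem partner_inlPos (p : Fin (2 * G.n)) :
    (G.connSum H).partner (G.inlPos H p) = G.inlPos H (G.partner p) := by
  unfold partner
  rw [chordOf_inlPos, connSum_overPos_castAdd, connSum_underPos_castAdd]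
  by_cases h : G.overPos (G.chordOf p) = p
  · rw [if_pos h, if_pos (by rw [h])]
  · rw [if_neg h]
    split_ifs with h'
    · exact (h (G.inlPos_injective H h')).elim
    · rfl

/-- The partner of a second-block point. [folklore] -/
theorem partner_inrPos (q : Fin (2 * H.n)) :
    (G.connSum H).partner (G.inrPos H q) = G.inrPos H (H.partner q) := by
  unfold partner
  rw [chordOf_inrPos, connSum_overPos_natAdd, connSum_underPos_natAdd]
  by_cases h : H.overPos (H.chordOf q) = q
  · rw [if_pos h, if_pos (by rw [h])]
  · rw [if_neg h]
    split_ifs with h'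
    · exact (h (G.inrPos_injective H h')).elim
    · rfl

variable (σ₁ : G.State) (σ₂ : H.State)

/-- A state of `G # H` restricted to the first block. [folklore] -/
@[simp] theorem append_castAdd (i : Fin G.n) :
    (Fin.append σ₁ σ₂ : (G.connSum H).State) (Fin.castAdd H.n i) = σ₁ i :=
  Fin.append_left σ₁ σ₂ i

/-- A state of `G # H` restricted to the second block. [folklore] -/
@[simp] theorem append_natAdd (j : Fin H.n) :
    (Fin.append σ₁ σ₂ : (G.connSum H).State) (Fin.natAdd G.n j) = σ₂ j :=
  Fin.append_right σ₁ σ₂ j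

/-- **Every state of `G # H` is a pair of states.** [folklore] -/
theorem state_eq_append (σ : (G.connSum H).State) :
    σ = Fin.append (fun i ↦ σ (Fin.castAdd H.n i)) (fun j ↦ σ (Fin.natAdd G.n j)) := by
  funext k
  induction k using Fin.addCases with
  | left i => simp
  | right j => simp

/-- The Seifert rule on the first block. [folklore] -/
@[simp] theorem isSeifert_append_castAdd (i : Fin G.n) :
    (G.connSum H).isSeifert (Fin.append σ₁ σ₂) (Fin.castAdd H.n i) = G.isSeifert σ₁ i := by
  simp [isSeifert]

/-- The Seifert rule on the second block. [folklore] -/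
@[simp] theorem isSeifert_append_natAdd (j : Fin H.n) :
    (G.connSum H).isSeifert (Fin.append σ₁ σ₂) (Fin.natAdd G.n j) = H.isSeifert σ₂ j := by
  simp [isSeifert]

/-- **The gluing of ends of `G # H` is the gluing of `G` on the first block.** [folklore] -/
theorem endGlue_inlEnd (e : Fin (2 * G.n) × Bool) :
    (G.connSum H).endGlue (Fin.append σ₁ σ₂) (G.inlEnd H e) = G.inlEnd H (G.endGlue σ₁ e) := by
  obtain ⟨p, b⟩ := e
  simp only [endGlue, inlEnd, partner_inlPos, chordOf_inlPos, isSeifert_append_castAdd]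

/-- **The gluing of ends of `G # H` is the gluing of `H` on the second block.** [folklore] -/
theorem endGlue_inrEnd (e : Fin (2 * H.n) × Bool) :
    (G.connSum H).endGlue (Fin.append σ₁ σ₂) (G.inrEnd H e) = G.inrEnd H (H.endGlue σ₂ e) := by
  obtain ⟨q, b⟩ := e
  simp only [endGlue, inrEnd, partner_inrPos, chordOf_inrPos, isSeifert_append_natAdd]

/-- Chords of different blocks are different. [folklore] -/
theorem natAdd_ne_castAdd (i : Fin G.n) (j : Fin H.n) : Fin.natAdd G.n j ≠ Fin.castAdd H.n i := by
  intro h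
  have := congrArg Fin.val h
  simp at this
  omega

/-- Flipping a smoothing in the first block. [folklore] -/
theorem append_update_left (i : Fin G.n) (c : Bool) :
    (Fin.append (Function.update σ₁ i c) σ₂ : (G.connSum H).State) =
      Function.update (Fin.append σ₁ σ₂) (Fin.castAdd H.n i) c := by
  funext k
  induction k using Fin.addCases with
  | left i' =>
    rw [append_castAdd]
    by_cases h : i' = i
    · subst h; simp
    · rw [Function.update_of_ne h, Function.update_of_ne (fun h' ↦ h (Fin.castAdd_injective _ _ h')),
        append_castAdd]
  | right j =>
    rw [append_natAdd, Function.update_of_ne (G.natAdd_ne_castAdd H i j), append_natAdd]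

/-- Flipping a smoothing in the second block. [folklore] -/
theorem append_update_right (j : Fin H.n) (c : Bool) :
    (Fin.append σ₁ (Function.update σ₂ j c) : (G.connSum H).State) =
      Function.update (Fin.append σ₁ σ₂) (Fin.natAdd G.n j) c := by
  funext k
  induction k using Fin.addCases with
  | left i =>
    rw [append_castAdd, Function.update_of_ne (G.natAdd_ne_castAdd H i j).symm, append_castAdd]
  | right j' =>
    rw [append_natAdd]
    by_cases h : j' = j
    · subst h; simp
    · rw [Function.update_of_ne h, Function.update_of_ne (fun h' ↦ h (Fin.natAdd_injective _ _ h')),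
        append_natAdd]

/-! ### Arcs of block points and of block ends -/

/-- The arc leaving a first-block point. [folklore] -/
theorem arcOut_inlPos (p : Fin (2 * G.n)) :
    (G.connSum H).arcOut (G.inlPos H p) = G.inlArc H (G.arcOut p) :=
  Fin.ext rfl

/-- The arc leaving a second-block point. [folklore] -/
theorem arcOut_inrPos (hH : 0 < H.n) (q : Fin (2 * H.n)) :
    (G.connSum H).arcOut (G.inrPos H q) = G.inrArc H (H.arcOut q) :=
  Fin.ext (by rw [inrArc_val G H hH]; rfl)

/-- The arc entering a first-block point other than the base point of `G`. [folklore] -/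
theorem arcIn_inlPos_of_ne (p : Fin (2 * G.n)) (hp : (p : ℕ) ≠ 0) :
    (G.connSum H).arcIn (G.inlPos H p) = G.inlArc H (G.arcIn p) := by
  refine Fin.ext ?_
  have hp' := p.isLt
  simp only [arcIn, inlPos_val, inlArc_val, connSum_n, Fin.val_mk]
  rw [show (p : ℕ) + 2 * (G.n + H.n) - 1 = (p - 1) + 2 * (G.n + H.n) by omega, Nat.add_mod_right,
    Nat.mod_eq_of_lt (by omega), show (p : ℕ) + 2 * G.n - 1 = (p - 1) + 2 * G.n by omega,
    Nat.add_mod_right, Nat.mod_eq_of_lt (by omega)]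

/-- **The arc entering the base point of `G` in `G # H` is the base arc of `H`.** [folklore] -/
theorem arcIn_inlPos_zero (hG : 0 < G.n) (hH : 0 < H.n) :
    (G.connSum H).arcIn (G.inlPos H ⟨0, by omega⟩) = G.inrArc H H.baseArc := by
  refine Fin.ext ?_
  rw [inrArc_val G H hH, val_baseArc]
  simp only [arcIn, inlPos_val, connSum_n, Fin.val_mk, zero_add]
  rw [Nat.mod_eq_of_lt (by omega)]
  omega

/-- The arc entering a second-block point other than the base point of `H`. [folklore] -/
theorem arcIn_inrPos_of_ne (hH : 0 < H.n) (q : Fin (2 * H.n)) (hq : (q : ℕ) ≠ 0) :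
    (G.connSum H).arcIn (G.inrPos H q) = G.inrArc H (H.arcIn q) := by
  refine Fin.ext ?_
  have hq' := q.isLt
  rw [inrArc_val G H hH]
  simp only [arcIn, inrPos_val, connSum_n, Fin.val_mk]
  rw [show 2 * G.n + (q : ℕ) + 2 * (G.n + H.n) - 1 = (2 * G.n + q - 1) + 2 * (G.n + H.n) by omega,
    Nat.add_mod_right, Nat.mod_eq_of_lt (by omega),
    show (q : ℕ) + 2 * H.n - 1 = (q - 1) + 2 * H.n by omega, Nat.add_mod_right,
    Nat.mod_eq_of_lt (by omega)]
  omega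

/-- **The arc entering the base point of `H` in `G # H` is the base arc of `G`.** [folklore] -/
theorem arcIn_inrPos_zero (hG : 0 < G.n) (hH : 0 < H.n) :
    (G.connSum H).arcIn (G.inrPos H ⟨0, by omega⟩) = G.inlArc H G.baseArc := by
  refine Fin.ext ?_
  rw [inlArc_val, val_baseArc]
  simp only [arcIn, inrPos_val, connSum_n, Fin.val_mk, add_zero]
  rw [show 2 * G.n + 2 * (G.n + H.n) - 1 = (2 * G.n - 1) + 2 * (G.n + H.n) by omega,
    Nat.add_mod_right, Nat.mod_eq_of_lt (by omega)]

/-- The head of the base arc of `G` is the end `(0, in)`. [folklore] -/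
theorem endArc_zero_false (hG : 0 < G.n) : G.endArc (⟨0, by omega⟩, false) = G.baseArc :=
  G.arcIn_zero hG

/-- The tail of the base arc of `G` is the end `(2 n - 1, out)`. [folklore] -/
theorem endArc_last_true (hG : 0 < G.n) : G.endArc (⟨2 * G.n - 1, by omega⟩, true) = G.baseArc :=
  G.arcOut_last hG

/-- The other end of the tail of the base arc is its head. [folklore] -/
theorem endFlip_last_true (hG : 0 < G.n) :
    G.endFlip (⟨2 * G.n - 1, by omega⟩, true) = (⟨0, by omega⟩, false) := by
  simp only [endFlip, G.succPt_last hG]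

/-- The other end of the head of the base arc is its tail. [folklore] -/
theorem endFlip_zero_false (hG : 0 < G.n) :
    G.endFlip (⟨0, by omega⟩, false) = (⟨2 * G.n - 1, by omega⟩, true) := by
  rw [← G.endFlip_last_true hG, endFlip_endFlip]

/-- **Arcs of first-block ends**: apart from the head `(0, in)` of the base arc of `G`, an end of
`G` belongs in `G # H` to the arc it belongs to in `G`. [folklore] -/
theorem endArc_inlEnd_of_ne (e : Fin (2 * G.n) × Bool) (he : e.2 = true ∨ (e.1 : ℕ) ≠ 0) :
    (G.connSum H).endArc (G.inlEnd H e) = G.inlArc H (G.endArc e) := by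
  obtain ⟨p, b⟩ := e
  cases b
  · have hp : (p : ℕ) ≠ 0 := by simpa using he
    exact G.arcIn_inlPos_of_ne H p hp
  · exact G.arcOut_inlPos H p

/-- **The head of the base arc of `G` is, in `G # H`, the head of the base arc of `H`.** [folklore] -/
theorem endArc_inlEnd_zero (hG : 0 < G.n) (hH : 0 < H.n) :
    (G.connSum H).endArc (G.inlEnd H (⟨0, by omega⟩, false)) = G.inrArc H H.baseArc :=
  G.arcIn_inlPos_zero H hG hH

/-- Arcs of second-block ends other than the head of the base arc of `H`. [folklore] -/
theorem endArc_inrEnd_of_ne (hH : 0 < H.n) (e : Fin (2 * H.n) × Bool) (he : e.2 = true ∨ (e.1 : ℕ) ≠ 0) :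
    (G.connSum H).endArc (G.inrEnd H e) = G.inrArc H (H.endArc e) := by
  obtain ⟨q, b⟩ := e
  cases b
  · have hq : (q : ℕ) ≠ 0 := by simpa using he
    exact G.arcIn_inrPos_of_ne H hH q hq
  · exact G.arcOut_inrPos H hH q

/-- **The head of the base arc of `H` is, in `G # H`, the head of the base arc of `G`.** [folklore] -/
theorem endArc_inrEnd_zero (hG : 0 < G.n) (hH : 0 < H.n) :
    (G.connSum H).endArc (G.inrEnd H (⟨0, by omega⟩, false)) = G.inlArc H G.baseArc :=
  G.arcIn_inrPos_zero H hG hH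

/-! ### Adjacency in a state graph, read on ends -/

/-- Distinct arcs carrying glued ends are adjacent in the state graph. [folklore] -/
theorem stateAdj_endArc_endGlue (τ : G.State) (e : Fin (2 * G.n) × Bool)
    (hne : G.endArc e ≠ G.endArc (G.endGlue τ e)) :
    G.stateAdj τ (G.endArc e) (G.endArc (G.endGlue τ e)) := by
  refine ⟨hne, ?_⟩
  obtain ⟨p, b⟩ := e
  cases hs : G.isSeifert τ (G.chordOf p) <;> cases b
  · exact ⟨p, Or.inr ⟨hs, Or.inl ⟨rfl, by simp [endArc, endGlue, hs]⟩⟩⟩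
  · exact ⟨p, Or.inr ⟨hs, Or.inr ⟨rfl, by simp [endArc, endGlue, hs]⟩⟩⟩
  · exact ⟨p, Or.inl ⟨hs, Or.inl ⟨rfl, by simp [endArc, endGlue, hs]⟩⟩⟩
  · refine ⟨G.partner p, Or.inl ⟨by simpa using hs, Or.inr ⟨?_, ?_⟩⟩⟩ <;>
      simp [endArc, endGlue, hs]

/-- **Adjacency in a state graph read on ends**: two arcs are adjacent iff they are distinct and
carry a pair of glued ends. Viro (2004), §5.2. [cite: Viro2004, §5.2] -/
theorem stateGraph_adj_iff_exists_end (τ : G.State) (u v : G.Arc) :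
    (G.stateGraph τ).Adj u v ↔ u ≠ v ∧ ∃ e, G.endArc e = u ∧ G.endArc (G.endGlue τ e) = v := by
  constructor
  · intro h
    exact ⟨h.ne, G.exists_end_of_stateGraph_adj τ h⟩
  · rintro ⟨hne, e, rfl, rfl⟩
    rw [stateGraph, SimpleGraph.fromRel_adj]
    exact ⟨hne, Or.inl (G.stateAdj_endArc_endGlue τ e hne)⟩


/-! ### Weights, crossing counts and Koszul signs of `G # H` -/

/-- Counting over `Fin (m + n)` blockwise. [folklore] -/
theorem card_filter_univ_add {m n : ℕ} (P : Fin (m + n) → Prop) [DecidablePred P] :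
    (Finset.univ.filter P).card =
      (Finset.univ.filter fun i : Fin m ↦ P (Fin.castAdd n i)).card +
        (Finset.univ.filter fun j : Fin n ↦ P (Fin.natAdd m j)).card := by
  simp only [Finset.card_filter]
  exact Fin.sum_univ_add _

/-- The number of `true` values of `Fin.append σ₁ σ₂`. [folklore] -/
theorem card_filter_append_eq_true {m n : ℕ} (σ₁ : Fin m → Bool) (σ₂ : Fin n → Bool) :
    (Finset.univ.filter fun k : Fin (m + n) ↦ Fin.append σ₁ σ₂ k = true).card =
      (Finset.univ.filter fun i : Fin m ↦ σ₁ i = true).card +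
        (Finset.univ.filter fun j : Fin n ↦ σ₂ j = true).card := by
  rw [card_filter_univ_add]
  simp

/-- The number of entries of `Fin.addCases f g` with a given value. [folklore] -/
theorem card_filter_addCases_eq {m n : ℕ} {α : Type*} [DecidableEq α] (f : Fin m → α) (g : Fin n → α)
    (u : α) :
    (Finset.univ.filter fun k : Fin (m + n) ↦ Fin.addCases (motive := fun _ ↦ α) f g k = u).card =
      (Finset.univ.filter fun i : Fin m ↦ f i = u).card +
        (Finset.univ.filter fun j : Fin n ↦ g j = u).card := by
  rw [card_filter_univ_add]
  simp

/-- The number of `true` values of `Fin.append σ₁ σ₂` before a first-block index. [folklore] -/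
theorem card_filter_lt_castAdd {m n : ℕ} (σ₁ : Fin m → Bool) (σ₂ : Fin n → Bool) (i : Fin m) :
    (Finset.univ.filter fun k : Fin (m + n) ↦ k < Fin.castAdd n i ∧ Fin.append σ₁ σ₂ k = true).card =
      (Finset.univ.filter fun j : Fin m ↦ j < i ∧ σ₁ j = true).card := by
  rw [card_filter_univ_add]
  have h0 : (Finset.univ.filter fun j : Fin n ↦
      Fin.natAdd m j < Fin.castAdd n i ∧ Fin.append σ₁ σ₂ (Fin.natAdd m j) = true).card = 0 := by
    rw [Finset.card_eq_zero, Finset.filter_eq_empty_iff]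
    rintro j - ⟨hj, -⟩
    rw [Fin.lt_def, Fin.val_natAdd, Fin.val_castAdd] at hj
    omega
  rw [h0, add_zero]
  refine congrArg Finset.card (Finset.filter_congr fun j _ ↦ ?_)
  rw [Fin.append_left, Fin.lt_def, Fin.lt_def, Fin.val_castAdd, Fin.val_castAdd]

/-- The number of `true` values of `Fin.append σ₁ σ₂` before a second-block index. [folklore] -/
theorem card_filter_lt_natAdd {m n : ℕ} (σ₁ : Fin m → Bool) (σ₂ : Fin n → Bool) (j : Fin n) :
    (Finset.univ.filter fun k : Fin (m + n) ↦ k < Fin.natAdd m j ∧ Fin.append σ₁ σ₂ k = true).card =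
      (Finset.univ.filter fun i : Fin m ↦ σ₁ i = true).card +
        (Finset.univ.filter fun j' : Fin n ↦ j' < j ∧ σ₂ j' = true).card := by
  rw [card_filter_univ_add]
  congr 1
  · refine congrArg Finset.card (Finset.filter_congr fun i _ ↦ ?_)
    rw [Fin.append_left, Fin.lt_def, Fin.val_castAdd, Fin.val_natAdd]
    have := i.isLt
    exact ⟨fun h ↦ h.2, fun h ↦ ⟨by omega, h⟩⟩
  · refine congrArg Finset.card (Finset.filter_congr fun j' _ ↦ ?_)
    rw [Fin.append_right, Fin.lt_def, Fin.lt_def, Fin.val_natAdd, Fin.val_natAdd]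
    exact and_congr ⟨fun h ↦ by omega, fun h ↦ by omega⟩ Iff.rfl

/-- **The weight of a state of `G # H` is the sum of the weights of its blocks.** [folklore] -/
theorem weight_append :
    State.weight (G := G.connSum H) (Fin.append σ₁ σ₂) = σ₁.weight + σ₂.weight :=
  card_filter_append_eq_true σ₁ σ₂

/-- `n₊` is additive under connected sum. [folklore] -/
theorem nPlus_connSum : (G.connSum H).nPlus = G.nPlus + H.nPlus :=
  card_filter_addCases_eq G.sign H.sign 1

/-- `n₋` is additive under connected sum. [folklore] -/
theorem nMinus_connSum : (G.connSum H).nMinus = G.nMinus + H.nMinus :=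
  card_filter_addCases_eq G.sign H.sign (-1)

/-- **Koszul signs on the first block are those of `G`** (the chords of `G` come first). Khovanov
(2000), §3.3. [cite: Khovanov2000, §3.3] -/
theorem edgeSign_append_castAdd (i : Fin G.n) :
    edgeSign (G := G.connSum H) (Fin.append σ₁ σ₂) (Fin.castAdd H.n i) = edgeSign σ₁ i :=
  congrArg (fun k : ℕ ↦ (-1 : ℤ) ^ k) (card_filter_lt_castAdd σ₁ σ₂ i)

/-- **Koszul signs on the second block are those of `H` times `(-1)^{|σ₁|}`** (all chords of `G`
precede those of `H`): the sign of the tensor product of complexes. Khovanov (2000), §3.3, §7.4.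
[cite: Khovanov2000, §3.3] -/
theorem edgeSign_append_natAdd (j : Fin H.n) :
    edgeSign (G := G.connSum H) (Fin.append σ₁ σ₂) (Fin.natAdd G.n j) =
      (-1) ^ σ₁.weight * edgeSign σ₂ j :=
  (congrArg (fun k : ℕ ↦ (-1 : ℤ) ^ k) (card_filter_lt_natAdd σ₁ σ₂ j)).trans (pow_add _ _ _)

end Blocks

/-! ## Trade: the state graph of `G # H` is the disjoint union with the base gluings traded -/

section Trade

/-- The end `(0, in)`: the **head of the base arc** (the end of the arc entering the base point,
at the base point). [folklore] -/
def IsBaseHead (e : Fin (2 * G.n) × Bool) : Prop :=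
  e.2 = false ∧ (e.1 : ℕ) = 0

/-- Being the head of the base arc is decidable. [folklore] -/
instance (e : Fin (2 * G.n) × Bool) : Decidable (G.IsBaseHead e) := by
  unfold IsBaseHead; infer_instance

/-- The head of the base arc, as an end (nonempty diagram). [folklore] -/
def baseHead (hG : 0 < G.n) : Fin (2 * G.n) × Bool :=
  (⟨0, by omega⟩, false)

/-- The head of the base arc is the head of the base arc. [folklore] -/
theorem isBaseHead_baseHead (hG : 0 < G.n) : G.IsBaseHead (G.baseHead hG) :=
  ⟨rfl, rfl⟩

/-- Characterisation of the head of the base arc. [folklore] -/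
theorem isBaseHead_iff (hG : 0 < G.n) (e : Fin (2 * G.n) × Bool) : G.IsBaseHead e ↔ e = G.baseHead hG := by
  obtain ⟨p, b⟩ := e
  constructor
  · rintro ⟨hb, hp⟩
    simp only at hb hp
    subst hb
    simp only [baseHead, Prod.mk.injEq, and_true]
    exact Fin.ext hp
  · rintro h
    cases h
    exact ⟨rfl, rfl⟩

/-- Not being the head of the base arc, unfolded. [folklore] -/
theorem not_isBaseHead_iff (e : Fin (2 * G.n) × Bool) : ¬ G.IsBaseHead e ↔ e.2 = true ∨ (e.1 : ℕ) ≠ 0 := by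
  obtain ⟨p, b⟩ := e
  cases b <;> simp [IsBaseHead]

/-- The arc of the head of the base arc is the base arc. [folklore] -/
theorem endArc_baseHead (hG : 0 < G.n) : G.endArc (G.baseHead hG) = G.baseArc :=
  G.endArc_zero_false hG

/-- The head of the base arc is glued to an end which is not the head of the base arc (the gluing
has no fixed point and moves the marked point). [folklore] -/
theorem not_isBaseHead_endGlue (τ : G.State) {e : Fin (2 * G.n) × Bool} (he : G.IsBaseHead e) :
    ¬ G.IsBaseHead (G.endGlue τ e) := by
  obtain ⟨p, b⟩ := e
  obtain ⟨hb, hp⟩ := he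
  simp only at hb hp
  subst hb
  rintro ⟨-, hq⟩
  simp only [endGlue] at hq
  have : G.partner p = p := Fin.ext (by rw [hq, hp])
  exact G.partner_ne p this

/-- The **ends of the blocks**: an end of `G` or an end of `H`. [folklore] -/
abbrev SumEnd : Type := (Fin (2 * G.n) × Bool) ⊕ (Fin (2 * H.n) × Bool)

/-- The end of `G # H` named by an end of a block. [folklore] -/
def sumEnd : G.SumEnd H → Fin (2 * (G.connSum H).n) × Bool :=
  Sum.elim (G.inlEnd H) (G.inrEnd H)

/-- The arc of a block end, **read in the disjoint union** `G ⊔ H`. [folklore] -/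
def sumEndArc : G.SumEnd H → G.Arc ⊕ H.Arc :=
  Sum.map G.endArc H.endArc

/-- The arc of a block end, **read in the connected sum** `G # H` and named in blocks: as in the
disjoint union, except that the two heads of the base arcs are traded (`endArc_inlEnd_zero`,
`endArc_inrEnd_zero`). [folklore] -/
def csEndArc : G.SumEnd H → G.Arc ⊕ H.Arc
  | Sum.inl e => if G.IsBaseHead e then Sum.inr H.baseArc else Sum.inl (G.endArc e)
  | Sum.inr e => if H.IsBaseHead e then Sum.inl G.baseArc else Sum.inr (H.endArc e)

/-- A block end is **a base head** if it is the head of the base arc of its block. [folklore] -/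
def IsSumBaseHead : G.SumEnd H → Prop :=
  Sum.elim G.IsBaseHead H.IsBaseHead

variable (σ₁ : G.State) (σ₂ : H.State)

/-- The blockwise gluing of block ends (the gluing of `G # H` read in blocks, `endGlue_sumEnd`).
[folklore] -/
def sumEndGlue : G.SumEnd H → G.SumEnd H :=
  Sum.map (G.endGlue σ₁) (H.endGlue σ₂)

/-- The blockwise gluing is an involution. [folklore] -/
@[simp] theorem sumEndGlue_sumEndGlue (x : G.SumEnd H) :
    G.sumEndGlue H σ₁ σ₂ (G.sumEndGlue H σ₁ σ₂ x) = x := by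
  rcases x with e | e <;> simp [sumEndGlue]

/-- A base head is glued to an end which is not a base head. [folklore] -/
theorem not_isSumBaseHead_sumEndGlue {x : G.SumEnd H} (hx : G.IsSumBaseHead H x) :
    ¬ G.IsSumBaseHead H (G.sumEndGlue H σ₁ σ₂ x) := by
  rcases x with e | e
  · exact G.not_isBaseHead_endGlue σ₁ hx
  · exact H.not_isBaseHead_endGlue σ₂ hx

/-- Off the base heads the two readings of the arc of an end agree. [folklore] -/
theorem csEndArc_of_not {x : G.SumEnd H} (hx : ¬ G.IsSumBaseHead H x) :
    G.csEndArc H x = G.sumEndArc H x := by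
  rcases x with e | e
  · exact if_neg hx
  · exact if_neg hx

/-- The arc of a base head read in the connected sum: the base arc of the *other* block. [folklore] -/
theorem csEndArc_of_isSumBaseHead {x : G.SumEnd H} (hx : G.IsSumBaseHead H x) :
    G.csEndArc H x = Sum.elim (fun _ ↦ Sum.inr H.baseArc) (fun _ ↦ Sum.inl G.baseArc) x := by
  rcases x with e | e
  · exact if_pos hx
  · exact if_pos hx

/-- The arc of a base head read in the disjoint union: the base arc of its block. [folklore] -/
theorem sumEndArc_of_isSumBaseHead (hG : 0 < G.n) (hH : 0 < H.n) {x : G.SumEnd H}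
    (hx : G.IsSumBaseHead H x) :
    G.sumEndArc H x = Sum.elim (fun _ ↦ Sum.inl G.baseArc) (fun _ ↦ Sum.inr H.baseArc) x := by
  rcases x with e | e
  · obtain rfl := (G.isBaseHead_iff hG e).1 hx
    simp [sumEndArc, endArc_baseHead]
  · obtain rfl := (H.isBaseHead_iff hH e).1 hx
    simp [sumEndArc, endArc_baseHead]

/-- **The gluing of `G # H` is the blockwise gluing.** [folklore] -/
theorem endGlue_sumEnd (x : G.SumEnd H) :
    (G.connSum H).endGlue (Fin.append σ₁ σ₂) (G.sumEnd H x) = G.sumEnd H (G.sumEndGlue H σ₁ σ₂ x) := by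
  rcases x with e | e
  · exact G.endGlue_inlEnd H σ₁ σ₂ e
  · exact G.endGlue_inrEnd H σ₁ σ₂ e

/-- Every end of `G # H` is named by a block end. [folklore] -/
theorem sumEnd_surjective : Surjective (G.sumEnd H) := by
  intro e
  rcases G.eq_inlEnd_or_eq_inrEnd H e with ⟨e₁, rfl⟩ | ⟨e₂, rfl⟩
  · exact ⟨Sum.inl e₁, rfl⟩
  · exact ⟨Sum.inr e₂, rfl⟩

/-- **The arc of an end of `G # H`**, read in blocks, is `csEndArc`. [folklore] -/
theorem arcEquiv_csEndArc (hG : 0 < G.n) (hH : 0 < H.n) (x : G.SumEnd H) :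
    G.arcEquiv H hG hH (G.csEndArc H x) = (G.connSum H).endArc (G.sumEnd H x) := by
  rcases x with e | e
  · by_cases he : G.IsBaseHead e
    · obtain rfl := (G.isBaseHead_iff hG e).1 he
      rw [csEndArc, if_pos he]
      exact (G.endArc_inlEnd_zero H hG hH).symm
    · rw [csEndArc, if_neg he]
      exact (G.endArc_inlEnd_of_ne H e ((G.not_isBaseHead_iff e).1 he)).symm
  · by_cases he : H.IsBaseHead e
    · obtain rfl := (H.isBaseHead_iff hH e).1 he
      rw [csEndArc, if_pos he]
      exact (G.endArc_inrEnd_zero H hG hH).symm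
    · rw [csEndArc, if_neg he]
      exact (G.endArc_inrEnd_of_ne H hH e ((H.not_isBaseHead_iff e).1 he)).symm

/-- **Adjacency in the disjoint union of the two state graphs, read on block ends.** [folklore] -/
theorem sumGraph_adj_iff (u v : G.Arc ⊕ H.Arc) :
    (G.stateGraph σ₁ ⊕g H.stateGraph σ₂).Adj u v ↔
      u ≠ v ∧ ∃ x, G.sumEndArc H x = u ∧ G.sumEndArc H (G.sumEndGlue H σ₁ σ₂ x) = v := by
  rcases u with a | b <;> rcases v with a' | b'
  · rw [SimpleGraph.sum_adj_inl, stateGraph_adj_iff_exists_end]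
    constructor
    · rintro ⟨hne, e, rfl, rfl⟩
      exact ⟨fun h ↦ hne (Sum.inl_injective h), Sum.inl e, rfl, rfl⟩
    · rintro ⟨hne, x, hx, hx'⟩
      rcases x with e | e
      · simp only [sumEndArc, sumEndGlue, Sum.map_inl, Sum.inl.injEq] at hx hx'
        exact ⟨fun h ↦ hne (congrArg Sum.inl h), e, hx, hx'⟩
      · simp [sumEndArc] at hx
  · constructor
    · exact fun h ↦ (SimpleGraph.not_adj_sum_inl_inr a b' h).elim
    · rintro ⟨-, x, hx, hx'⟩
      rcases x with e | e <;> simp [sumEndArc, sumEndGlue] at hx hx'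
  · constructor
    · exact fun h ↦ (SimpleGraph.not_adj_sum_inl_inr a' b h.symm).elim
    · rintro ⟨-, x, hx, hx'⟩
      rcases x with e | e <;> simp [sumEndArc, sumEndGlue] at hx hx'
  · rw [SimpleGraph.sum_adj_inr, stateGraph_adj_iff_exists_end]
    constructor
    · rintro ⟨hne, e, rfl, rfl⟩
      exact ⟨fun h ↦ hne (Sum.inr_injective h), Sum.inr e, rfl, rfl⟩
    · rintro ⟨hne, x, hx, hx'⟩
      rcases x with e | e
      · simp [sumEndArc] at hx
      · simp only [sumEndArc, sumEndGlue, Sum.map_inr, Sum.inr.injEq] at hx hx'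
        exact ⟨fun h ↦ hne (congrArg Sum.inr h), e, hx, hx'⟩

/-- **Adjacency in the state graph of `G # H`, read on block ends** (pulled back to
`G.Arc ⊕ H.Arc` along `arcEquiv`). [folklore] -/
theorem connSumGraph_adj_iff (hG : 0 < G.n) (hH : 0 < H.n) (u v : G.Arc ⊕ H.Arc) :
    (((G.connSum H).stateGraph (Fin.append σ₁ σ₂)).comap (G.arcEquiv H hG hH)).Adj u v ↔
      u ≠ v ∧ ∃ x, G.csEndArc H x = u ∧ G.csEndArc H (G.sumEndGlue H σ₁ σ₂ x) = v := by
  rw [SimpleGraph.comap_adj, stateGraph_adj_iff_exists_end]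
  have hinj := (G.arcEquiv H hG hH).injective
  constructor
  · rintro ⟨hne, e, he, he'⟩
    obtain ⟨x, rfl⟩ := G.sumEnd_surjective H e
    rw [← G.arcEquiv_csEndArc H hG hH] at he
    rw [endGlue_sumEnd, ← G.arcEquiv_csEndArc H hG hH] at he'
    exact ⟨fun h ↦ hne (congrArg _ h), x, hinj he, hinj he'⟩
  · rintro ⟨hne, x, rfl, rfl⟩
    refine ⟨fun h ↦ hne (hinj h), G.sumEnd H x, ?_, ?_⟩
    · rw [arcEquiv_csEndArc]
    · rw [endGlue_sumEnd, arcEquiv_csEndArc]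

/-! ### The edge trade -/

/-- Glued block ends carry arcs which are connected (equal or adjacent) in the disjoint union of the
state graphs. [folklore] -/
theorem reachable_sumEndArc_sumEndGlue (x : G.SumEnd H) :
    (G.stateGraph σ₁ ⊕g H.stateGraph σ₂).Reachable (G.sumEndArc H x)
      (G.sumEndArc H (G.sumEndGlue H σ₁ σ₂ x)) := by
  by_cases h : G.sumEndArc H x = G.sumEndArc H (G.sumEndGlue H σ₁ σ₂ x)
  · rw [← h]
  · exact SimpleGraph.Adj.reachable ((G.sumGraph_adj_iff H σ₁ σ₂ _ _).2 ⟨h, x, rfl, rfl⟩)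

/-- Glued block ends carry arcs which are connected (equal or adjacent) in the state graph of
`G # H`. [folklore] -/
theorem reachable_csEndArc_sumEndGlue (hG : 0 < G.n) (hH : 0 < H.n) (x : G.SumEnd H) :
    (((G.connSum H).stateGraph (Fin.append σ₁ σ₂)).comap (G.arcEquiv H hG hH)).Reachable
      (G.csEndArc H x) (G.csEndArc H (G.sumEndGlue H σ₁ σ₂ x)) := by
  by_cases h : G.csEndArc H x = G.csEndArc H (G.sumEndGlue H σ₁ σ₂ x)
  · rw [← h]
  · exact SimpleGraph.Adj.reachable ((G.connSumGraph_adj_iff H σ₁ σ₂ hG hH _ _).2 ⟨h, x, rfl, rfl⟩)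

/-- **Every edge of the state graph of `G # H` is an edge of the disjoint union or one of the two
traded pairs** `{base arc of G, partner of the head of the base arc of H}`,
`{base arc of H, partner of the head of the base arc of G}`. [folklore] -/
theorem adj_connSumGraph_imp (hG : 0 < G.n) (hH : 0 < H.n) (u v : G.Arc ⊕ H.Arc)
    (h : (((G.connSum H).stateGraph (Fin.append σ₁ σ₂)).comap (G.arcEquiv H hG hH)).Adj u v) :
    (G.stateGraph σ₁ ⊕g H.stateGraph σ₂).Adj u v ∨
      s(u, v) = s(Sum.inl G.baseArc,
        G.sumEndArc H (G.sumEndGlue H σ₁ σ₂ (Sum.inr (H.baseHead hH)))) ∨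
      s(u, v) = s(Sum.inr H.baseArc,
        G.sumEndArc H (G.sumEndGlue H σ₁ σ₂ (Sum.inl (G.baseHead hG)))) := by
  obtain ⟨hne, x, hu, hv⟩ := (G.connSumGraph_adj_iff H σ₁ σ₂ hG hH u v).1 h
  by_cases h1 : G.IsSumBaseHead H x
  · have hgx := G.csEndArc_of_not H (G.not_isSumBaseHead_sumEndGlue H σ₁ σ₂ h1)
    rw [G.csEndArc_of_isSumBaseHead H h1] at hu
    rw [hgx] at hv
    rcases x with e | e
    · obtain rfl := (G.isBaseHead_iff hG e).1 h1
      subst hu hv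
      exact Or.inr (Or.inr rfl)
    · obtain rfl := (H.isBaseHead_iff hH e).1 h1
      subst hu hv
      exact Or.inr (Or.inl rfl)
  · by_cases h2 : G.IsSumBaseHead H (G.sumEndGlue H σ₁ σ₂ x)
    · have hx : x = G.sumEndGlue H σ₁ σ₂ (G.sumEndGlue H σ₁ σ₂ x) :=
        (G.sumEndGlue_sumEndGlue H σ₁ σ₂ x).symm
      rw [G.csEndArc_of_not H h1] at hu
      rw [G.csEndArc_of_isSumBaseHead H h2] at hv
      generalize hx' : G.sumEndGlue H σ₁ σ₂ x = x' at h2 hv hx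
      subst hx
      rcases x' with e | e
      · obtain rfl := (G.isBaseHead_iff hG e).1 h2
        subst hu hv
        exact Or.inr (Or.inr Sym2.eq_swap)
      · obtain rfl := (H.isBaseHead_iff hH e).1 h2
        subst hu hv
        exact Or.inr (Or.inl Sym2.eq_swap)
    · rw [G.csEndArc_of_not H h1] at hu
      rw [G.csEndArc_of_not H h2] at hv
      exact Or.inl ((G.sumGraph_adj_iff H σ₁ σ₂ u v).2 ⟨hne, x, hu, hv⟩)

/-- **Every edge of the disjoint union is an edge of the state graph of `G # H` or one of the two
pairs** `{base arc of G, partner of its head}`, `{base arc of H, partner of its head}`. [folklore] -/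
theorem adj_sumGraph_imp (hG : 0 < G.n) (hH : 0 < H.n) (u v : G.Arc ⊕ H.Arc)
    (h : (G.stateGraph σ₁ ⊕g H.stateGraph σ₂).Adj u v) :
    (((G.connSum H).stateGraph (Fin.append σ₁ σ₂)).comap (G.arcEquiv H hG hH)).Adj u v ∨
      s(u, v) = s(Sum.inl G.baseArc,
        G.sumEndArc H (G.sumEndGlue H σ₁ σ₂ (Sum.inl (G.baseHead hG)))) ∨
      s(u, v) = s(Sum.inr H.baseArc,
        G.sumEndArc H (G.sumEndGlue H σ₁ σ₂ (Sum.inr (H.baseHead hH)))) := by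
  obtain ⟨hne, x, hu, hv⟩ := (G.sumGraph_adj_iff H σ₁ σ₂ u v).1 h
  by_cases h1 : G.IsSumBaseHead H x
  · have hgx := G.csEndArc_of_not H (G.not_isSumBaseHead_sumEndGlue H σ₁ σ₂ h1)
    rw [G.sumEndArc_of_isSumBaseHead H hG hH h1] at hu
    rcases x with e | e
    · obtain rfl := (G.isBaseHead_iff hG e).1 h1
      subst hu hv
      exact Or.inr (Or.inl rfl)
    · obtain rfl := (H.isBaseHead_iff hH e).1 h1
      subst hu hv
      exact Or.inr (Or.inr rfl)
  · by_cases h2 : G.IsSumBaseHead H (G.sumEndGlue H σ₁ σ₂ x)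
    · have hx : x = G.sumEndGlue H σ₁ σ₂ (G.sumEndGlue H σ₁ σ₂ x) :=
        (G.sumEndGlue_sumEndGlue H σ₁ σ₂ x).symm
      rw [G.sumEndArc_of_isSumBaseHead H hG hH h2] at hv
      generalize hx' : G.sumEndGlue H σ₁ σ₂ x = x' at h2 hv hx
      subst hx
      rcases x' with e | e
      · obtain rfl := (G.isBaseHead_iff hG e).1 h2
        subst hu hv
        exact Or.inr (Or.inl Sym2.eq_swap)
      · obtain rfl := (H.isBaseHead_iff hH e).1 h2
        subst hu hv
        exact Or.inr (Or.inr Sym2.eq_swap)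
    · rw [← G.csEndArc_of_not H h1] at hu
      rw [← G.csEndArc_of_not H h2] at hv
      exact Or.inl ((G.connSumGraph_adj_iff H σ₁ σ₂ hG hH u v).2 ⟨hne, x, hu, hv⟩)

/-! ## Walk: the two base arcs lie on one circle of `G # H` -/

/-- **Odd alternating words in two fixed-point-free involutions have no fixed point**:
`φ (g φ)ᵏ x ≠ x` (such a word is a conjugate of `φ` or of `g`). Used for walking around a state
circle: the walk from the head of an arc never meets that head again before meeting the tail.
[folklore] -/
theorem apply_iterate_comp_ne {α : Type*} {g φ : α → α} (hg : Involutive g) (hφ : Involutive φ)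
    (hg' : ∀ x, g x ≠ x) (hφ' : ∀ x, φ x ≠ x) (k : ℕ) (x : α) : φ ((g ∘ φ)^[k] x) ≠ x := by
  induction k using Nat.twoStepInduction generalizing x with
  | zero => exact hφ' x
  | one =>
    intro h
    simp only [Function.iterate_one, Function.comp_apply] at h
    apply hg' (φ x)
    have := congrArg φ h
    rwa [hφ] at this
  | more k ih _ =>
    intro h
    rw [Function.iterate_succ_apply, Function.iterate_succ_apply'] at h
    simp only [Function.comp_apply] at h
    -- `h : φ (g (φ ((g ∘ φ)^[k] (g (φ x))))) = x`
    have h2 : g (φ ((g ∘ φ)^[k] (g (φ x)))) = φ x := by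
      have := congrArg φ h
      rwa [hφ] at this
    have h3 : φ ((g ∘ φ)^[k] (g (φ x))) = g (φ x) := by
      have := congrArg g h2
      rwa [hg] at this
    exact ih (g (φ x)) h3

/-- The gluing of ends as a permutation. [folklore] -/
def endGluePerm (τ : G.State) : _root_.Equiv.Perm (Fin (2 * G.n) × Bool) :=
  Function.Involutive.toPerm (G.endGlue τ) (G.endGlue_endGlue τ)

/-- **Walking around a circle from the head of the base arc one reaches its tail**: some iterate
of "cross the glue, cross the arc" starting after the head of the base arc is the tail of the base
arc (the circle closes up). [folklore] -/
theorem exists_iterate_eq_endFlip_baseHead (hG : 0 < G.n) (τ : G.State) :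
    ∃ k, (G.endGlue τ ∘ G.endFlip)^[k] (G.endGlue τ (G.baseHead hG)) = G.endFlip (G.baseHead hG) := by
  set ψ : _root_.Equiv.Perm (Fin (2 * G.n) × Bool) := G.endGluePerm τ * G.endFlipPerm with hψ
  have hcoe : ⇑ψ = G.endGlue τ ∘ G.endFlip := by
    rw [hψ, _root_.Equiv.Perm.coe_mul]
    rfl
  obtain ⟨m, hm⟩ : ∃ m, orderOf ψ = m + 1 := Nat.exists_eq_add_one_of_ne_zero (orderOf_pos ψ).ne'
  refine ⟨m, ?_⟩
  have hfix : (ψ ^ (m + 1)) (G.endFlip (G.baseHead hG)) = G.endFlip (G.baseHead hG) := by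
    rw [← hm, pow_orderOf_eq_one]; rfl
  rw [_root_.Equiv.Perm.coe_pow, Function.iterate_succ_apply, hcoe] at hfix
  simpa [Function.comp_apply, endFlip_endFlip] using hfix

/-- The walk around the base circle of `H` inside `G # H`: as long as the tail of the base arc of `H`
has not been met, the arcs visited are connected to the base arc of `G` in the state graph of
`G # H`. [folklore] -/
theorem reachable_baseArc_iterate (hG : 0 < G.n) (hH : 0 < H.n) (k : ℕ)
    (hk : ∀ j < k, (H.endGlue σ₂ ∘ H.endFlip)^[j] (H.endGlue σ₂ (H.baseHead hH)) ≠ H.endFlip (H.baseHead hH)) :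
    (((G.connSum H).stateGraph (Fin.append σ₁ σ₂)).comap (G.arcEquiv H hG hH)).Reachable
      (Sum.inl G.baseArc)
      (G.csEndArc H (Sum.inr ((H.endGlue σ₂ ∘ H.endFlip)^[k] (H.endGlue σ₂ (H.baseHead hH))))) := by
  induction k with
  | zero =>
    have h0 := G.reachable_csEndArc_sumEndGlue H σ₁ σ₂ hG hH (Sum.inr (H.baseHead hH))
    rw [G.csEndArc_of_isSumBaseHead H (x := Sum.inr (H.baseHead hH)) (H.isBaseHead_baseHead hH)] at h0
    simpa [sumEndGlue] using h0
  | succ k ih =>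
    have ih' := ih (fun j hj ↦ hk j (Nat.lt_succ_of_lt hj))
    set u := (H.endGlue σ₂ ∘ H.endFlip)^[k] (H.endGlue σ₂ (H.baseHead hH)) with hu
    -- `u` is neither the tail nor the head of the base arc of `H`
    have hut : u ≠ H.endFlip (H.baseHead hH) := hk k (Nat.lt_succ_self k)
    have huh : u ≠ H.baseHead hH := by
      intro h
      have : (H.endGlue σ₂ ∘ H.endFlip)^[k + 1] (H.endFlip (H.baseHead hH)) = H.baseHead hH := by
        rw [Function.iterate_succ_apply, Function.comp_apply, endFlip_endFlip, ← hu, h]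
      have hne := apply_iterate_comp_ne (H.endGlue_endGlue σ₂) H.endFlip_endFlip (H.endGlue_ne σ₂)
        H.endFlip_ne (k + 1) (H.endFlip (H.baseHead hH))
      rw [this] at hne
      exact hne rfl
    -- hence its arc, and the arc of its flip, are read alike in `G # H`
    have hφu : ¬ G.IsSumBaseHead H (Sum.inr (H.endFlip u)) := by
      intro h
      have h' := (H.isBaseHead_iff hH _).1 h
      exact hut (by rw [← h', endFlip_endFlip])
    have hu' : ¬ G.IsSumBaseHead H (Sum.inr u) := fun h ↦ huh ((H.isBaseHead_iff hH _).1 h)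
    have e1 : G.csEndArc H (Sum.inr u) = G.csEndArc H (Sum.inr (H.endFlip u)) := by
      rw [G.csEndArc_of_not H hu', G.csEndArc_of_not H hφu]
      simp [sumEndArc, endArc_endFlip]
    have step := G.reachable_csEndArc_sumEndGlue H σ₁ σ₂ hG hH (Sum.inr (H.endFlip u))
    rw [← e1] at step
    have e2 : G.sumEndGlue H σ₁ σ₂ (Sum.inr (H.endFlip u)) =
        Sum.inr ((H.endGlue σ₂ ∘ H.endFlip)^[k + 1] (H.endGlue σ₂ (H.baseHead hH))) := by
      rw [Function.iterate_succ_apply', ← hu]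
      rfl
    rw [e2] at step
    exact ih'.trans step

/-- **The two base arcs lie on one state circle of `G # H`**, in every state. [folklore] -/
theorem reachable_baseArc (hG : 0 < G.n) (hH : 0 < H.n) :
    (((G.connSum H).stateGraph (Fin.append σ₁ σ₂)).comap (G.arcEquiv H hG hH)).Reachable
      (Sum.inl G.baseArc) (Sum.inr H.baseArc) := by
  classical
  let P : ℕ → Prop := fun k ↦
    (H.endGlue σ₂ ∘ H.endFlip)^[k] (H.endGlue σ₂ (H.baseHead hH)) = H.endFlip (H.baseHead hH)
  have hex : ∃ k, P k := H.exists_iterate_eq_endFlip_baseHead hH σ₂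
  have hr := G.reachable_baseArc_iterate H σ₁ σ₂ hG hH (Nat.find hex)
    (fun j hj ↦ Nat.find_min hex hj)
  rw [(Nat.find_spec hex : P (Nat.find hex))] at hr
  have ht : ¬ G.IsSumBaseHead H (Sum.inr (H.endFlip (H.baseHead hH))) := by
    rintro ⟨h, -⟩
    simp [baseHead, endFlip_zero_false H hH] at h
  rw [G.csEndArc_of_not H ht] at hr
  simpa [sumEndArc, baseHead, endFlip_zero_false H hH, endArc_last_true H hH] using hr

/-! ## Circles: the surgery relation and its corollaries -/

/-- **Reachability in the state graph of `G # H` is merged reachability in the disjoint union**: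
the circles of `G # H` in the state `(σ₁, σ₂)` are those of `σ₁` and of `σ₂` with the two base
circles united (the abstract edge trade `reachable_trade_iff_mergedReach`). Rasmussen (2010),
Lemma 3.8 / Fig. 3; Khovanov (2000), §7.4. [cite: Rasmussen2010, Lemma 3.8] -/
theorem reachable_connSum_iff_mergedReach (hG : 0 < G.n) (hH : 0 < H.n) (u v : G.Arc ⊕ H.Arc) :
    (((G.connSum H).stateGraph (Fin.append σ₁ σ₂)).comap (G.arcEquiv H hG hH)).Reachable u v ↔
      MergedReach (G.stateGraph σ₁ ⊕g H.stateGraph σ₂) (Sum.inl G.baseArc) (Sum.inr H.baseArc) u v := by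
  refine reachable_trade_iff_mergedReach
    (x := G.sumEndArc H (G.sumEndGlue H σ₁ σ₂ (Sum.inl (G.baseHead hG))))
    (y := G.sumEndArc H (G.sumEndGlue H σ₁ σ₂ (Sum.inr (H.baseHead hH))))
    (G.adj_connSumGraph_imp H σ₁ σ₂ hG hH) (G.adj_sumGraph_imp H σ₁ σ₂ hG hH) ?_ ?_ ?_ ?_
    (G.reachable_baseArc H σ₁ σ₂ hG hH)
  · have := G.reachable_sumEndArc_sumEndGlue H σ₁ σ₂ (Sum.inl (G.baseHead hG))
    rwa [G.sumEndArc_of_isSumBaseHead H hG hH (x := Sum.inl (G.baseHead hG)) (G.isBaseHead_baseHead hG)] at this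
  · have := G.reachable_sumEndArc_sumEndGlue H σ₁ σ₂ (Sum.inr (H.baseHead hH))
    rwa [G.sumEndArc_of_isSumBaseHead H hG hH (x := Sum.inr (H.baseHead hH)) (H.isBaseHead_baseHead hH)] at this
  · have := G.reachable_csEndArc_sumEndGlue H σ₁ σ₂ hG hH (Sum.inr (H.baseHead hH))
    rwa [G.csEndArc_of_isSumBaseHead H (x := Sum.inr (H.baseHead hH)) (H.isBaseHead_baseHead hH),
      G.csEndArc_of_not H (G.not_isSumBaseHead_sumEndGlue H σ₁ σ₂ (x := Sum.inr (H.baseHead hH))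
        (H.isBaseHead_baseHead hH))] at this
  · have := G.reachable_csEndArc_sumEndGlue H σ₁ σ₂ hG hH (Sum.inl (G.baseHead hG))
    rwa [G.csEndArc_of_isSumBaseHead H (x := Sum.inl (G.baseHead hG)) (G.isBaseHead_baseHead hG),
      G.csEndArc_of_not H (G.not_isSumBaseHead_sumEndGlue H σ₁ σ₂ (x := Sum.inl (G.baseHead hG))
        (G.isBaseHead_baseHead hG))] at this

end Trade

section Circles

variable (σ₁ : G.State) (σ₂ : H.State)

/-- Reachability in the disjoint union of the two state graphs is "same block, same circle".
[folklore] -/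
theorem reachable_sumGraph_iff (u v : G.Arc ⊕ H.Arc) :
    (G.stateGraph σ₁ ⊕g H.stateGraph σ₂).Reachable u v ↔
      Sum.map (G.circleOf σ₁) (H.circleOf σ₂) u = Sum.map (G.circleOf σ₁) (H.circleOf σ₂) v := by
  constructor
  · intro h
    refine rel_of_reachable (R := fun u v ↦
      Sum.map (G.circleOf σ₁) (H.circleOf σ₂) u = Sum.map (G.circleOf σ₁) (H.circleOf σ₂) v)
      ⟨fun _ ↦ rfl, fun h ↦ h.symm, fun h₁ h₂ ↦ h₁.trans h₂⟩ (fun u v huv ↦ ?_) h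
    rcases u with a | b <;> rcases v with a' | b'
    · simpa [circleOf, SimpleGraph.ConnectedComponent.eq] using
        (SimpleGraph.sum_adj_inl.1 huv).reachable
    · exact (SimpleGraph.not_adj_sum_inl_inr a b' huv).elim
    · exact (SimpleGraph.not_adj_sum_inl_inr a' b huv.symm).elim
    · simpa [circleOf, SimpleGraph.ConnectedComponent.eq] using
        (SimpleGraph.sum_adj_inr.1 huv).reachable
  · intro h
    rcases u with a | b <;> rcases v with a' | b'
    · simp only [Sum.map_inl, Sum.inl.injEq, circleOf, SimpleGraph.ConnectedComponent.eq] at h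
      exact h.map (SimpleGraph.Embedding.sumInl (G := G.stateGraph σ₁) (H := H.stateGraph σ₂)).toHom
    · simp at h
    · simp at h
    · simp only [Sum.map_inr, Sum.inr.injEq, circleOf, SimpleGraph.ConnectedComponent.eq] at h
      exact h.map (SimpleGraph.Embedding.sumInr (G := G.stateGraph σ₁) (H := H.stateGraph σ₂)).toHom

/-- Reachability in the state graph of `G # H`, pulled back to blocks, is "same circle of `G # H`".
[folklore] -/
theorem reachable_connSumGraph_iff (hG : 0 < G.n) (hH : 0 < H.n) (u v : G.Arc ⊕ H.Arc) :
    (((G.connSum H).stateGraph (Fin.append σ₁ σ₂)).comap (G.arcEquiv H hG hH)).Reachable u v ↔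
      (G.connSum H).circleOf (Fin.append σ₁ σ₂) (G.arcEquiv H hG hH u) =
        (G.connSum H).circleOf (Fin.append σ₁ σ₂) (G.arcEquiv H hG hH v) := by
  rw [circleOf, circleOf, SimpleGraph.ConnectedComponent.eq,
    ← (SimpleGraph.Iso.comap (G.arcEquiv H hG hH) ((G.connSum H).stateGraph (Fin.append σ₁ σ₂))).reachable_iff]
  rfl

/-- **The state circles of a connected sum (surgery form).** In the state `(σ₁, σ₂)` of `G # H`,
read on the arcs `G.Arc ⊕ H.Arc` of the blocks, the circle map of `G # H` is obtained from the
blockwise circle map by uniting the two base circles (the circles through the base arcs of `G` and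
of `H`): this is the abstract surgery relation `KhFace.Surg` of `KhFaces` (a merge, read from the
disjoint union `G ⊔ H` to `G # H`) at the two base arcs. Every resolution of `D₁ # D₂` is the
connected sum of a resolution of `D₁` and one of `D₂` along the base arcs — the combinatorial
content of Rasmussen (2010), Fig. 3 / Lemma 3.8 and of Khovanov (2000), §7.4.
[cite: Rasmussen2010, Lemma 3.8] -/
theorem connSum_surg (hG : 0 < G.n) (hH : 0 < H.n) :
    KhFace.Surg (Sum.map (G.circleOf σ₁) (H.circleOf σ₂))
      ((G.connSum H).circleOf (Fin.append σ₁ σ₂) ∘ G.arcEquiv H hG hH)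
      (Sum.inl G.baseArc) (Sum.inr H.baseArc) where
  ne := by simp
  rel u v := by
    rw [Function.comp_apply, Function.comp_apply,
      ← reachable_connSumGraph_iff, reachable_connSum_iff_mergedReach, MergedReach,
      reachable_sumGraph_iff, reachable_sumGraph_iff, reachable_sumGraph_iff, reachable_sumGraph_iff,
      reachable_sumGraph_iff]
    constructor
    · rintro (h | ⟨h₁, h₂⟩ | ⟨h₁, h₂⟩)
      · exact Or.inl h
      · exact Or.inr ⟨Or.inl h₁, Or.inr h₂.symm⟩
      · exact Or.inr ⟨Or.inr h₁, Or.inl h₂.symm⟩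
    · rintro (h | ⟨h₁ | h₁, h₂ | h₂⟩)
      · exact Or.inl h
      · exact Or.inl (h₁.trans h₂.symm)
      · exact Or.inr (Or.inl ⟨h₁, h₂.symm⟩)
      · exact Or.inr (Or.inr ⟨h₁, h₂.symm⟩)
      · exact Or.inl (h₁.trans h₂.symm)

/-- **Circles of the first block embed**: two arcs of `G` lie on one circle of `G # H` iff they lie
on one circle of `G`. [folklore] -/
theorem circleOf_inlArc_eq_iff (hG : 0 < G.n) (hH : 0 < H.n) (a a' : G.Arc) :
    (G.connSum H).circleOf (Fin.append σ₁ σ₂) (G.inlArc H a) =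
        (G.connSum H).circleOf (Fin.append σ₁ σ₂) (G.inlArc H a') ↔
      G.circleOf σ₁ a = G.circleOf σ₁ a' := by
  have h := (G.connSum_surg H σ₁ σ₂ hG hH).rel (Sum.inl a) (Sum.inl a')
  simp only [Function.comp_apply, arcEquiv_inl, Sum.map_inl, Sum.inl.injEq, Sum.map_inr, reduceCtorEq,
    or_false] at h
  rw [h]
  constructor
  · rintro (h | ⟨h₁, h₂⟩)
    · exact h
    · exact h₁.trans h₂.symm
  · exact Or.inl

/-- **Circles of the second block embed.** [folklore] -/
theorem circleOf_inrArc_eq_iff (hG : 0 < G.n) (hH : 0 < H.n) (b b' : H.Arc) :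
    (G.connSum H).circleOf (Fin.append σ₁ σ₂) (G.inrArc H b) =
        (G.connSum H).circleOf (Fin.append σ₁ σ₂) (G.inrArc H b') ↔
      H.circleOf σ₂ b = H.circleOf σ₂ b' := by
  have h := (G.connSum_surg H σ₁ σ₂ hG hH).rel (Sum.inr b) (Sum.inr b')
  simp only [Function.comp_apply, arcEquiv_inr, Sum.map_inr, Sum.inr.injEq, Sum.map_inl, reduceCtorEq,
    false_or] at h
  rw [h]
  constructor
  · rintro (h | ⟨h₁, h₂⟩)
    · exact h
    · exact h₁.trans h₂.symm
  · exact Or.inl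

/-- **The mixed case**: an arc of `G` and an arc of `H` lie on one circle of `G # H` iff both lie
on the base circles of their blocks (which `G # H` unites). [folklore] -/
theorem circleOf_inlArc_eq_inrArc_iff (hG : 0 < G.n) (hH : 0 < H.n) (a : G.Arc) (b : H.Arc) :
    (G.connSum H).circleOf (Fin.append σ₁ σ₂) (G.inlArc H a) =
        (G.connSum H).circleOf (Fin.append σ₁ σ₂) (G.inrArc H b) ↔
      G.circleOf σ₁ a = G.circleOf σ₁ G.baseArc ∧ H.circleOf σ₂ b = H.circleOf σ₂ H.baseArc := by
  have h := (G.connSum_surg H σ₁ σ₂ hG hH).rel (Sum.inl a) (Sum.inr b)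
  simp only [Function.comp_apply, arcEquiv_inl, arcEquiv_inr, Sum.map_inl, Sum.map_inr, reduceCtorEq,
    Sum.inl.injEq, or_false, Sum.inr.injEq, false_or] at h
  exact h

/-- **Merges are blockwise (first block).** The flip at a chord of `G` is a merge in `G # H` iff it
is a merge in `G`. [folklore] -/
theorem isMergeAt_append_castAdd (hG : 0 < G.n) (hH : 0 < H.n) (i : Fin G.n) :
    (G.connSum H).IsMergeAt (Fin.append σ₁ σ₂) (Fin.castAdd H.n i) ↔ G.IsMergeAt σ₁ i := by
  simp only [IsMergeAt, append_castAdd, connSum_overPos_castAdd, arcOut_inlPos]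
  refine and_congr_right fun _ ↦ not_congr ?_
  by_cases hp : ((G.overPos i : Fin (2 * G.n)) : ℕ) = 0
  · have hp' : G.overPos i = ⟨0, by omega⟩ := Fin.ext hp
    rw [hp', arcIn_inlPos_zero G H hG hH, eq_comm, circleOf_inlArc_eq_inrArc_iff G H σ₁ σ₂ hG hH,
      arcIn_zero G hG]
    simp [eq_comm]
  · rw [arcIn_inlPos_of_ne G H _ hp, circleOf_inlArc_eq_iff G H σ₁ σ₂ hG hH]

/-- **Merges are blockwise (second block).** [folklore] -/
theorem isMergeAt_append_natAdd (hG : 0 < G.n) (hH : 0 < H.n) (j : Fin H.n) :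
    (G.connSum H).IsMergeAt (Fin.append σ₁ σ₂) (Fin.natAdd G.n j) ↔ H.IsMergeAt σ₂ j := by
  simp only [IsMergeAt, append_natAdd, connSum_overPos_natAdd, arcOut_inrPos G H hH]
  refine and_congr_right fun _ ↦ not_congr ?_
  by_cases hq : ((H.overPos j : Fin (2 * H.n)) : ℕ) = 0
  · have hq' : H.overPos j = ⟨0, by omega⟩ := Fin.ext hq
    rw [hq', arcIn_inrPos_zero G H hG hH, circleOf_inlArc_eq_inrArc_iff G H σ₁ σ₂ hG hH,
      arcIn_zero H hH]
    simp [eq_comm]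
  · rw [arcIn_inrPos_of_ne G H hH _ hq, circleOf_inrArc_eq_iff G H σ₁ σ₂ hG hH]

/-- **Splits are blockwise (first block).** [folklore] -/
theorem isSplitAt_append_castAdd (hG : 0 < G.n) (hH : 0 < H.n) (i : Fin G.n) :
    (G.connSum H).IsSplitAt (Fin.append σ₁ σ₂) (Fin.castAdd H.n i) ↔ G.IsSplitAt σ₁ i := by
  simp only [IsSplitAt, append_castAdd, connSum_overPos_castAdd, arcOut_inlPos]
  erw [← G.append_update_left H σ₁ σ₂ i true]
  refine and_congr_right fun _ ↦ not_congr ?_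
  by_cases hp : ((G.overPos i : Fin (2 * G.n)) : ℕ) = 0
  · have hp' : G.overPos i = ⟨0, by omega⟩ := Fin.ext hp
    rw [hp', arcIn_inlPos_zero G H hG hH, eq_comm,
      circleOf_inlArc_eq_inrArc_iff G H (Function.update σ₁ i true) σ₂ hG hH, arcIn_zero G hG]
    simp [eq_comm]
  · rw [arcIn_inlPos_of_ne G H _ hp, circleOf_inlArc_eq_iff G H (Function.update σ₁ i true) σ₂ hG hH]

/-- **Splits are blockwise (second block).** [folklore] -/
theorem isSplitAt_append_natAdd (hG : 0 < G.n) (hH : 0 < H.n) (j : Fin H.n) :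
    (G.connSum H).IsSplitAt (Fin.append σ₁ σ₂) (Fin.natAdd G.n j) ↔ H.IsSplitAt σ₂ j := by
  simp only [IsSplitAt, append_natAdd, connSum_overPos_natAdd, arcOut_inrPos G H hH]
  erw [← G.append_update_right H σ₁ σ₂ j true]
  refine and_congr_right fun _ ↦ not_congr ?_
  by_cases hq : ((H.overPos j : Fin (2 * H.n)) : ℕ) = 0
  · have hq' : H.overPos j = ⟨0, by omega⟩ := Fin.ext hq
    rw [hq', arcIn_inrPos_zero G H hG hH,
      circleOf_inlArc_eq_inrArc_iff G H σ₁ (Function.update σ₂ j true) hG hH, arcIn_zero H hH]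
    simp [eq_comm]
  · rw [arcIn_inrPos_of_ne G H hH _ hq, circleOf_inrArc_eq_iff G H σ₁ (Function.update σ₂ j true) hG hH]

/-- **The merge/split dichotomy passes to connected sums**: if every flip of `G` and of `H` is a
merge or a split (as for all-even, in particular realisable, diagrams), so is every flip of `G # H`.
Viro (2004), §5.2. [cite: Viro2004, §5.2] -/
theorem dichotomy_connSum (hG : 0 < G.n) (hH : 0 < H.n)
    (h₁ : ∀ (σ : G.State) (i : Fin G.n), σ i = false → G.IsMergeAt σ i ∨ G.IsSplitAt σ i)
    (h₂ : ∀ (σ : H.State) (j : Fin H.n), σ j = false → H.IsMergeAt σ j ∨ H.IsSplitAt σ j)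
    (σ : (G.connSum H).State) (k : Fin (G.connSum H).n) (hk : σ k = false) :
    (G.connSum H).IsMergeAt σ k ∨ (G.connSum H).IsSplitAt σ k := by
  rw [G.state_eq_append H σ] at hk ⊢
  induction k using Fin.addCases with
  | left i =>
    rw [isMergeAt_append_castAdd G H _ _ hG hH, isSplitAt_append_castAdd G H _ _ hG hH]
    exact h₁ _ i (by simpa using hk)
  | right j =>
    rw [isMergeAt_append_natAdd G H _ _ hG hH, isSplitAt_append_natAdd G H _ _ hG hH]
    exact h₂ _ j (by simpa using hk)

end Circles

section CircleMaps

variable (σ₁ : G.State) (σ₂ : H.State)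

/-- **A circle of `σ₁` as a circle of `G # H`** (well defined and injective by
`circleOf_inlArc_eq_iff`). [folklore] -/
def inlCircle (hG : 0 < G.n) (hH : 0 < H.n) :
    G.StateCircle σ₁ → (G.connSum H).StateCircle (Fin.append σ₁ σ₂) :=
  SimpleGraph.ConnectedComponent.lift
    (fun a ↦ (G.connSum H).circleOf (Fin.append σ₁ σ₂) (G.inlArc H a))
    (fun v w p _ ↦ (G.circleOf_inlArc_eq_iff H σ₁ σ₂ hG hH v w).2
      (SimpleGraph.ConnectedComponent.sound p.reachable))

/-- **A circle of `σ₂` as a circle of `G # H`.** [folklore] -/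
def inrCircle (hG : 0 < G.n) (hH : 0 < H.n) :
    H.StateCircle σ₂ → (G.connSum H).StateCircle (Fin.append σ₁ σ₂) :=
  SimpleGraph.ConnectedComponent.lift
    (fun b ↦ (G.connSum H).circleOf (Fin.append σ₁ σ₂) (G.inrArc H b))
    (fun v w p _ ↦ (G.circleOf_inrArc_eq_iff H σ₁ σ₂ hG hH v w).2
      (SimpleGraph.ConnectedComponent.sound p.reachable))

/-- `inlCircle` on the circle of an arc. [folklore] -/
@[simp] theorem inlCircle_circleOf (hG : 0 < G.n) (hH : 0 < H.n) (a : G.Arc) :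
    G.inlCircle H σ₁ σ₂ hG hH (G.circleOf σ₁ a) =
      (G.connSum H).circleOf (Fin.append σ₁ σ₂) (G.inlArc H a) := rfl

/-- `inrCircle` on the circle of an arc. [folklore] -/
@[simp] theorem inrCircle_circleOf (hG : 0 < G.n) (hH : 0 < H.n) (b : H.Arc) :
    G.inrCircle H σ₁ σ₂ hG hH (H.circleOf σ₂ b) =
      (G.connSum H).circleOf (Fin.append σ₁ σ₂) (G.inrArc H b) := rfl

/-- `inlCircle` is injective. [folklore] -/
theorem inlCircle_injective (hG : 0 < G.n) (hH : 0 < H.n) :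
    Injective (G.inlCircle H σ₁ σ₂ hG hH) := by
  intro C C' h
  induction C using SimpleGraph.ConnectedComponent.ind with | h a => ?_
  induction C' using SimpleGraph.ConnectedComponent.ind with | h a' => ?_
  exact (G.circleOf_inlArc_eq_iff H σ₁ σ₂ hG hH a a').1 h

/-- `inrCircle` is injective. [folklore] -/
theorem inrCircle_injective (hG : 0 < G.n) (hH : 0 < H.n) :
    Injective (G.inrCircle H σ₁ σ₂ hG hH) := by
  intro C C' h
  induction C using SimpleGraph.ConnectedComponent.ind with | h b => ?_
  induction C' using SimpleGraph.ConnectedComponent.ind with | h b' => ?_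
  exact (G.circleOf_inrArc_eq_iff H σ₁ σ₂ hG hH b b').1 h

/-- **The two base circles become one circle of `G # H`**, and no other circle of `σ₁` is a
circle of `σ₂`. [folklore] -/
theorem inlCircle_eq_inrCircle_iff (hG : 0 < G.n) (hH : 0 < H.n) (C : G.StateCircle σ₁)
    (C' : H.StateCircle σ₂) :
    G.inlCircle H σ₁ σ₂ hG hH C = G.inrCircle H σ₁ σ₂ hG hH C' ↔
      C = G.circleOf σ₁ G.baseArc ∧ C' = H.circleOf σ₂ H.baseArc := by
  induction C using SimpleGraph.ConnectedComponent.ind with | h a => ?_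
  induction C' using SimpleGraph.ConnectedComponent.ind with | h b => ?_
  exact G.circleOf_inlArc_eq_inrArc_iff H σ₁ σ₂ hG hH a b

/-- The merged base circle. [folklore] -/
theorem inlCircle_baseArc (hG : 0 < G.n) (hH : 0 < H.n) :
    G.inlCircle H σ₁ σ₂ hG hH (G.circleOf σ₁ G.baseArc) =
      G.inrCircle H σ₁ σ₂ hG hH (H.circleOf σ₂ H.baseArc) :=
  (G.inlCircle_eq_inrCircle_iff H σ₁ σ₂ hG hH _ _).2 ⟨rfl, rfl⟩

/-- **Every circle of `G # H` is a circle of a block.** [folklore] -/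
theorem exists_eq_inlCircle_or (hG : 0 < G.n) (hH : 0 < H.n)
    (C : (G.connSum H).StateCircle (Fin.append σ₁ σ₂)) :
    (∃ C₁, C = G.inlCircle H σ₁ σ₂ hG hH C₁) ∨ ∃ C₂, C = G.inrCircle H σ₁ σ₂ hG hH C₂ := by
  induction C using SimpleGraph.ConnectedComponent.ind with | h r => ?_
  obtain ⟨x, rfl⟩ := (G.arcEquiv H hG hH).surjective r
  rcases x with a | b
  · exact Or.inl ⟨G.circleOf σ₁ a, rfl⟩
  · exact Or.inr ⟨H.circleOf σ₂ b, rfl⟩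

/-- The circles of `G # H` are the images of the two circle maps. [folklore] -/
theorem image_inlCircle_union_image_inrCircle (hG : 0 < G.n) (hH : 0 < H.n) :
    Finset.univ.image (G.inlCircle H σ₁ σ₂ hG hH) ∪ Finset.univ.image (G.inrCircle H σ₁ σ₂ hG hH) =
      Finset.univ := by
  ext C
  simp only [Finset.mem_union, Finset.mem_image, Finset.mem_univ, true_and, iff_true]
  rcases G.exists_eq_inlCircle_or H σ₁ σ₂ hG hH C with ⟨C₁, rfl⟩ | ⟨C₂, rfl⟩
  · exact Or.inl ⟨C₁, rfl⟩
  · exact Or.inr ⟨C₂, rfl⟩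

/-- The two images meet in the merged base circle only. [folklore] -/
theorem image_inlCircle_inter_image_inrCircle (hG : 0 < G.n) (hH : 0 < H.n) :
    Finset.univ.image (G.inlCircle H σ₁ σ₂ hG hH) ∩ Finset.univ.image (G.inrCircle H σ₁ σ₂ hG hH) =
      {G.inlCircle H σ₁ σ₂ hG hH (G.circleOf σ₁ G.baseArc)} := by
  ext C
  simp only [Finset.mem_inter, Finset.mem_image, Finset.mem_univ, true_and, Finset.mem_singleton]
  constructor
  · rintro ⟨⟨C₁, rfl⟩, C₂, h⟩
    obtain ⟨rfl, -⟩ := (G.inlCircle_eq_inrCircle_iff H σ₁ σ₂ hG hH C₁ C₂).1 h.symm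
    rfl
  · rintro rfl
    exact ⟨⟨_, rfl⟩, _, (G.inlCircle_baseArc H σ₁ σ₂ hG hH).symm⟩

/-- **Summing over the circles of `G # H`**: a sum over the circles of `G # H` plus the value at
the merged base circle is the sum over the circles of `σ₁` plus the sum over the circles of `σ₂`
(of the values at their images). [folklore] -/
theorem sum_stateCircle_connSum (hG : 0 < G.n) (hH : 0 < H.n) {M : Type*} [AddCommMonoid M]
    (f : (G.connSum H).StateCircle (Fin.append σ₁ σ₂) → M) :
    ∑ C, f C + f (G.inlCircle H σ₁ σ₂ hG hH (G.circleOf σ₁ G.baseArc)) =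
      ∑ C₁, f (G.inlCircle H σ₁ σ₂ hG hH C₁) + ∑ C₂, f (G.inrCircle H σ₁ σ₂ hG hH C₂) := by
  classical
  rw [← Finset.sum_image (f := f) fun C₁ _ C₁' _ h ↦ G.inlCircle_injective H σ₁ σ₂ hG hH h,
    ← Finset.sum_image (f := f) fun C₂ _ C₂' _ h ↦ G.inrCircle_injective H σ₁ σ₂ hG hH h,
    ← Finset.sum_union_inter, image_inlCircle_union_image_inrCircle,
    image_inlCircle_inter_image_inrCircle, Finset.sum_singleton]

/-- **Products over the circles of `G # H`** (multiplicative form of `sum_stateCircle_connSum`).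
[folklore] -/
theorem prod_stateCircle_connSum (hG : 0 < G.n) (hH : 0 < H.n) {M : Type*} [CommMonoid M]
    (f : (G.connSum H).StateCircle (Fin.append σ₁ σ₂) → M) :
    (∏ C, f C) * f (G.inlCircle H σ₁ σ₂ hG hH (G.circleOf σ₁ G.baseArc)) =
      (∏ C₁, f (G.inlCircle H σ₁ σ₂ hG hH C₁)) * ∏ C₂, f (G.inrCircle H σ₁ σ₂ hG hH C₂) := by
  classical
  rw [← Finset.prod_image (f := f) fun C₁ _ C₁' _ h ↦ G.inlCircle_injective H σ₁ σ₂ hG hH h,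
    ← Finset.prod_image (f := f) fun C₂ _ C₂' _ h ↦ G.inrCircle_injective H σ₁ σ₂ hG hH h,
    ← Finset.prod_union_inter, image_inlCircle_union_image_inrCircle,
    image_inlCircle_inter_image_inrCircle, Finset.prod_singleton]

/-- **Counting the circles of a connected sum**: `#circles(σ₁ # σ₂) + 1 = #circles(σ₁) + #circles(σ₂)`
(the two base circles become one). Rasmussen (2010), Fig. 3; Khovanov (2000), §7.4.
[cite: Rasmussen2010, Lemma 3.8] -/
theorem circleCount_connSum (hG : 0 < G.n) (hH : 0 < H.n) :
    (G.connSum H).circleCount (Fin.append σ₁ σ₂) + 1 = G.circleCount σ₁ + H.circleCount σ₂ := by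
  have h := G.sum_stateCircle_connSum H σ₁ σ₂ hG hH (fun _ ↦ (1 : ℕ))
  simpa [circleCount, Finset.card_univ] using h

end CircleMaps

end GaussDiagram

end Literature.Topology.FourManifolds
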